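import Literature.AlgebraicTopology.SingularHomology.BoundaryPiecesDuality
import Literature.AlgebraicTopology.SingularHomology.RelativeCochainsVanishing
import Literature.AlgebraicTopology.SingularHomology.LefschetzDualityProofs
import Literature.AlgebraicTopology.SingularHomology.BoundaryClassGeneratorZero
import Literature.AlgebraicTopology.SingularHomology.PoincareDualityProofs
import Literature.AlgebraicTopology.SingularHomology.NoncompactManifoldProofs
import HarnessLib

/-!
# Poincaré–Lefschetz duality for a split boundary, vanishing form (Hatcher Thm. 3.43 with Thm. 3.2)

A. Hatcher, *Algebraic Topology* (2002), §3.3, Thm. 3.43: for a compact `R`-orientable manifold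
`M` whose boundary is the union of two compact pieces `A`, `B` with `∂A = ∂B = A ∩ B`, cap product
with a fundamental class gives isomorphisms `Hᵏ(M, A; R) ≅ Hₙ₋ₖ(M, B; R)`; proof (p. 254): Lefschetz
duality for `(M, ∂M)`, Poincaré duality for `∂M`, the five lemma, and "the boundary map
`Hₙ(M, ∂M) → Hₙ₋₁(∂M)` sends a fundamental class for `M` to a fundamental class for `∂M`".
Combined with the universal coefficient theorem (Thm. 3.2) this is how C. T. C. Wall (*On simply
connected 4-manifolds*, J. London Math. Soc. 39 (1964), p. 146) concludes
"`Hₖ(R, M₁) ≅ H⁵⁻ᵏ(R, M₂) = 0`".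

This file proves the VANISHING consequence for a compact `ℤ`-oriented manifold with boundary `W`
(charts in `EuclideanHalfSpace (n+1)`, `W : Type`, a relative fundamental class
`z ∈ Hₙ₊₁(W, ∂W; ℤ)` given) whose boundary is the disjoint union of two closed subsets `A`, `B`:

> if `Hⱼ(W, B; ℤ) = 0` for all `j ≤ m`, then `Hₖ(W, A; ℤ) = 0` for all `k ≥ n + 1 - m`

(`isZero_relativeSingularHomology_of_boundary_split_typeZero`), along Hatcher's proof but
probing the duality ladder only for injectivity/surjectivity, so that no relative cohomology or cap
product of the triad is needed:

* `isZero_relativeSingularHomology_boundary_of_lt` — `Hᵢ(W, ∂W) = 0` for `i > n + 1`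
  (Lemma 3.27(b) along the compact `K = W` of the external collar, Hatcher p. 253);
* `isZero_relativeSingularHomology_of_boundary_split_of_duality` — the argument proper, for any
  `n`, GIVEN a relative fundamental class `z` such that capping with `∂z` is bijective on the
  boundary `P = ↥∂W` (Poincaré duality of `∂W`): Lefschetz duality `a ↦ a ⌢ z`
  (`bijective_relCapProduct_of_isRelFundamentalClass_holds`, Spanier 6.3.12), the splitting
  `P ≅ B ⊔ A'` and the block-diagonal form of duality (`BoundaryPiecesDuality.lean`), the square
  `∂_T(a ⌢ z) = ± r(f⁎(i^*a ⌢ c_B))`, universal coefficients for the pair `(W, B)`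
  (`RelativeCochainsVanishing.lean`: `i^* : Hᵖ(W) → Hᵖ(B)` is into for `p ≤ m`, onto for `p < m`),
  the exact sequence of the triple `A ⊆ ∂W ⊆ W`, and in degree `0` the surjection
  `H₀(B) → H₀(W)`;
* `isZero_relativeSingularHomology_of_boundary_split_typeZero` — the boundary orientation
  (`∂z` generates every `Hₙ(∂W | x)`, Spanier Cor. 6.3.10: `BoundaryClassGenerator.lean` for
  `n ≠ 0`, `BoundaryClassGeneratorZero.lean` for `n = 0`) and Poincaré duality
  (`poincare_duality`, Thm. 3.30) supply that hypothesis, for every `n`.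

Everything is proved; no named facts, no new definitions.

## References

* A. Hatcher, *Algebraic Topology*, CUP 2002, §3.3 Thm. 3.43 (p. 254), Prop. 3.25, Lemma 3.27,
  Thm. 3.30, proof of Prop. 3.42; §3.1 Thm. 3.2, p. 200; §2.1 p. 118. [HatcherAT2002]
* E. H. Spanier, *Algebraic Topology*, Springer 1981, Ch. 6 §3 Cor. 10, Thm. 12. [Spanier1981]
* C. T. C. Wall, *On simply-connected 4-manifolds*, J. London Math. Soc. 39 (1964), p. 146.
  [WallJLMS1964]
-/

noncomputable section

open CategoryTheory Limits Set Topology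
open scoped Manifold Topology

universe u v

namespace Literature.AlgebraicTopology.SingularHomology

/-- **`Hᵢ(W, ∂W; M) = 0` for `i > n + 1`** (`W : Type` compact Hausdorff, charted on the half-space
`EuclideanHalfSpace (n+1)`): `Hᵢ(W, ∂W) ≅ Hᵢ(X | K)` for the external collar `X` and `K = incl W`
compact (Hatcher 2002, p. 253), and `Hᵢ(X | K) = 0` for `i > n + 1` (Lemma 3.27(b)).
[cite: HatcherAT2002, §3.3 Lemma 3.27(b) and p. 253] -/
theorem isZero_relativeSingularHomology_boundary_of_lt (R : Type v) [CommRing R] (M : Type v)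
    [AddCommGroup M] [Module R M] {n : ℕ} {W : Type} [TopologicalSpace W] [T2Space W] [CompactSpace W]
    [ChartedSpace (EuclideanHalfSpace (n + 1)) W] {i : ℕ} (hi : n + 1 < i) :
    IsZero (relativeSingularHomology R M W ((𝓡∂ (n + 1)).boundary W) i) := by
  have hP := clocalHomology.ptDetermined_of_isCompact R M (X := ExtCollar n W) (Nat.le_add_left 1 n)
    (ExtCollar.isCompact_range_incl (n := n) (W := W))
  exact (hP.1 i hi).of_iso
    (ExtCollar.toExtCollar R M i ≪≫ localHomologyOfSet.cmpIso R M (ExtCollar n W) (range (ExtCollar.incl n)) i)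

/-! ### The vanishing theorem, given duality on the boundary -/

section Core

variable {n : ℕ} {W : Type} [TopologicalSpace W] [T2Space W] [CompactSpace W]
  [ChartedSpace (EuclideanHalfSpace (n + 1)) W]

/-- **Hatcher's Thm. 3.43 with Thm. 3.2, vanishing form, given duality on the boundary.**  Let
`W : Type` be compact Hausdorff, charted on `EuclideanHalfSpace (n+1)`, with
boundary `∂W = A ⊔ B` (`A`, `B` closed and disjoint), `z ∈ Hₙ₊₁(W, ∂W; ℤ)` a relative fundamental
class such that `b ↦ b ⌢ ∂z : Hᵖ(∂W; ℤ) → H_q(∂W; ℤ)` is bijective for all `p + q = n`.  If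
`Hⱼ(W, B; ℤ) = 0` for all `j ≤ m` then `Hₖ(W, A; ℤ) = 0` for all `k` with `n + 1 ≤ k + m`.
Proof (Hatcher p. 254 + Thm. 3.2, probed for vanishing): with `P = ↥∂W ≅ B ⊔ A'`, `∂z = f⁎ c_B + c_A`,
the boundary map of the triple `∂_T : H_{q+1}(W, ∂W) → H_q(P, A')` satisfies
`∂_T (a ⌢ z) = ± r f⁎((i^* a) ⌢ c_B)`; `a ↦ a ⌢ z` is bijective (Lefschetz), `c ↦ c ⌢ c_B` and
`r ∘ f⁎` are bijective (block form of the boundary duality), so `∂_T` is onto/into exactly when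
`i^* : Hᵖ(W) → Hᵖ(B)` is, i.e. (universal coefficients for `(W, B)`) for `p < m` / `p ≤ m`; the
exact sequence of the triple then kills `Hₖ(W, A)`. [cite: HatcherAT2002, §3.3 Thm. 3.43 (proof, p. 254) with Thm. 3.2] -/
theorem isZero_relativeSingularHomology_of_boundary_split_of_duality {m : ℕ}
    {A B : Set W} (hA : IsClosed A) (hB : IsClosed B) (hdisj : Disjoint A B)
    (hAB : A ∪ B = (𝓡∂ (n + 1)).boundary W)
    (z : relativeSingularHomology ℤ ℤ W ((𝓡∂ (n + 1)).boundary W) (n + 1))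
    (hz : IsRelFundamentalClass ℤ ((𝓡∂ (n + 1)).boundary W) z)
    (hD : ∀ (p q : ℕ) (h : p + q = n), Function.Bijective
      fun b : singularCohomology ℤ ℤ (↥((𝓡∂ (n + 1)).boundary W)) p =>
        capProduct (M := ℤ) h b (relativeSingularHomology.δ ℤ ℤ W ((𝓡∂ (n + 1)).boundary W) n z))
    (hyp : ∀ j, j ≤ m → IsZero (relativeSingularHomology ℤ ℤ W B j)) (k : ℕ) (hk : n + 1 ≤ k + m) :
    IsZero (relativeSingularHomology ℤ ℤ W A k) := by
  -- the boundary `P = ↥∂W`, a closed `n`-manifold, and its two pieces `B` and `A' = ∂W ↓∩ A`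
  letI := boundaryTopChartedSpace (n := n) (W := W)
  haveI : CompactSpace ↥((𝓡∂ (n + 1)).boundary W) := isCompact_iff_compactSpace.mp isCompact_boundary
  have hBbd : B ⊆ (𝓡∂ (n + 1)).boundary W := hAB ▸ subset_union_right
  have hAbd : A ⊆ (𝓡∂ (n + 1)).boundary W := hAB ▸ subset_union_left
  let f : C(↥B, ↥((𝓡∂ (n + 1)).boundary W)) := subsetInclusion hBbd
  haveI : CompactSpace ↥B := isCompact_iff_compactSpace.mp hB.isCompact
  haveI : CompactSpace ↥(Subtype.val ⁻¹' A : Set ↥((𝓡∂ (n + 1)).boundary W)) :=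
    isCompact_iff_compactSpace.mp (hA.preimage continuous_subtype_val).isCompact
  -- `P ≅ B ⊔ A'`
  obtain ⟨e, hef, heg⟩ := exists_sumHomeomorph_of_isClosed_cover f
    (subsetIncl (Subtype.val ⁻¹' A : Set ↥((𝓡∂ (n + 1)).boundary W)))
    (fun b b' h => Subtype.ext (congrArg (fun p : ↥((𝓡∂ (n + 1)).boundary W) => (p : W)) h))
    Subtype.val_injective
    (by
      refine Set.disjoint_left.mpr ?_
      rintro p ⟨b, rfl⟩ ⟨a, ha⟩
      have h2 : ((subsetIncl (Subtype.val ⁻¹' A : Set ↥((𝓡∂ (n + 1)).boundary W)) a : W)) ∈ A := a.2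
      rw [ha] at h2
      exact (Set.disjoint_left.mp hdisj h2) b.2)
    (by
      ext p
      simp only [mem_union, mem_range, mem_univ, iff_true]
      have hp : (p : W) ∈ A ∪ B := by rw [hAB]; exact p.2
      rcases hp with hpA | hpB
      · exact Or.inr ⟨⟨p, hpA⟩, rfl⟩
      · exact Or.inl ⟨⟨p, hpB⟩, Subtype.ext rfl⟩)
  have hsplit := fun j => exists_eq_map_add_map (R := ℤ) (M := ℤ) f (subsetIncl _) e hef heg j
  have hinj := fun {j : ℕ} (c₁ : singularHomology ℤ ℤ (↥B) j)
      (c₂ : singularHomology ℤ ℤ (↥(Subtype.val ⁻¹' A : Set ↥((𝓡∂ (n + 1)).boundary W))) j)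
      (h : singularHomology.map ℤ ℤ f j c₁ +
        singularHomology.map ℤ ℤ (subsetIncl (Subtype.val ⁻¹' A : Set ↥((𝓡∂ (n + 1)).boundary W))) j c₂ = 0) =>
    eq_zero_of_map_add_map_eq_zero (R := ℤ) (M := ℤ) f (subsetIncl _) e hef heg h
  have hext := fun j => exists_cohomology_extension (R := ℤ) (M := ℤ) f (subsetIncl _) e hef heg j
  -- the pieces of `∂z`
  obtain ⟨cB, cA, hc⟩ := hsplit n (relativeSingularHomology.δ ℤ ℤ W _ n z)
  -- Lefschetz duality for `(W, ∂W)`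
  have hL : ∀ (p q : ℕ) (h : p + q = n + 1),
      Function.Bijective fun a : singularCohomology ℤ ℤ W p => relCapProduct (M := ℤ) ((𝓡∂ (n + 1)).boundary W) h a z :=
    fun p q h => bijective_relCapProduct_of_isRelFundamentalClass_holds n W z hz h
  -- duality on the piece `B` and `r ∘ f⁎`
  have hDB : ∀ (p q : ℕ) (h : p + q = n),
      Function.Bijective fun a : singularCohomology ℤ ℤ (↥B) p => capProduct (M := ℤ) h a cB := by
    intro p q h
    refine bijective_capProduct_piece f (subsetIncl _) h (fun c₁ c₂ hc0 => hinj c₁ c₂ hc0) (hext p) cB cA ?_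
    rw [← hc]
    exact hD p q h
  have hE : ∀ q : ℕ, Function.Bijective fun y : singularHomology ℤ ℤ (↥B) q =>
      relativeSingularHomology.ofAbsolute ℤ ℤ (↥((𝓡∂ (n + 1)).boundary W)) (Subtype.val ⁻¹' A) q (singularHomology.map ℤ ℤ f q y) :=
    fun q => bijective_ofAbsolute_comp_map f (Subtype.val ⁻¹' A) q (hsplit q) (fun c₁ c₂ h0 => hinj c₁ c₂ h0)
      (fun j _ c₂ h0 => (hinj (0 : singularHomology ℤ ℤ (↥B) j) c₂ (by rw [map_zero, zero_add, h0])).2)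
  -- universal coefficients for `(W, B)`
  have hmonoB : ∀ p, p ≤ m → Function.Injective (singularCohomology.map ℤ ℤ (subsetIncl B) p) :=
    fun p hp => (ModuleCat.mono_iff_injective _).mp (mono_cohomologyMap_subsetIncl_of_le (M := ℤ) B hyp hp)
  have hepiB : ∀ p, p < m → Function.Surjective (singularCohomology.map ℤ ℤ (subsetIncl B) p) :=
    fun p hp => (ModuleCat.epi_iff_surjective _).mp (epi_cohomologyMap_subsetIncl_of_lt (M := ℤ) B hyp hp)
  -- vanishing above the dimension: `H_{q+1}(W, ∂W) = 0` and `H_q(P, A') = 0` for `q > n`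
  have hV2 : ∀ q, n < q → IsZero (relativeSingularHomology ℤ ℤ (↥((𝓡∂ (n + 1)).boundary W)) (Subtype.val ⁻¹' A) q) := by
    intro q hq
    have hP0 : IsZero (singularHomology ℤ ℤ (↥((𝓡∂ (n + 1)).boundary W)) q) :=
      isZero_singularHomology_of_lt_holds ℤ ℤ (↥((𝓡∂ (n + 1)).boundary W)) n hq
    have hB0 : ∀ y : singularHomology ℤ ℤ (↥B) q, y = 0 := fun y => by
      haveI := ModuleCat.subsingleton_of_isZero hP0
      exact (hinj y (0 : singularHomology ℤ ℤ (↥(Subtype.val ⁻¹' A : Set ↥((𝓡∂ (n + 1)).boundary W))) q)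
        (Subsingleton.elim _ _)).1
    haveI : Subsingleton (relativeSingularHomology ℤ ℤ (↥((𝓡∂ (n + 1)).boundary W)) (Subtype.val ⁻¹' A) q) :=
      ⟨fun x x' => by
        obtain ⟨y, rfl⟩ := (hE q).2 x
        obtain ⟨y', rfl⟩ := (hE q).2 x'
        simp only [hB0 y, hB0 y']⟩
    exact ModuleCat.isZero_of_subsingleton _
  -- the boundary map of the triple is into / onto in the right degrees
  have hθmono : ∀ q, (q ≤ n → n ≤ q + m) → Mono (relativeSingularHomology.tripleδ ℤ ℤ W ((𝓡∂ (n + 1)).boundary W) A q) := by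
    intro q hq
    by_cases hqn : q ≤ n
    · obtain ⟨p, hp⟩ : ∃ p, p + q = n := ⟨n - q, by omega⟩
      refine (ModuleCat.mono_iff_injective _).mpr ?_
      refine injective_of_square (R := ℤ) (u := (-1 : ℤ) ^ p) ((isUnit_one.neg).pow p)
        (e := (singularHomology.map ℤ ℤ f q ≫ relativeSingularHomology.ofAbsolute ℤ ℤ (↥((𝓡∂ (n + 1)).boundary W)) (Subtype.val ⁻¹' A) q).hom)
        (D' := fun c : singularCohomology ℤ ℤ (↥B) p => capProduct (M := ℤ) hp c cB)
        (ρ := singularCohomology.map ℤ ℤ (subsetIncl B) p)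
        (D := fun a : singularCohomology ℤ ℤ W p => relCapProduct (M := ℤ) ((𝓡∂ (n + 1)).boundary W) (show p + (q + 1) = n + 1 by omega) a z)
        (fun a => tripleδ_relCapProduct ((𝓡∂ (n + 1)).boundary W) A f hp z cB cA hc a)
        (hL p (q + 1) (by omega)).2 (hE q).1 (hDB p q hp).1 (hmonoB p (by omega))
    · rw [not_le] at hqn
      exact (isZero_relativeSingularHomology_boundary_of_lt ℤ ℤ (W := W) (by omega : n + 1 < q + 1)).mono _
  have hθepi : ∀ q, (q ≤ n → n < q + m) → Epi (relativeSingularHomology.tripleδ ℤ ℤ W ((𝓡∂ (n + 1)).boundary W) A q) := by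
    intro q hq
    by_cases hqn : q ≤ n
    · obtain ⟨p, hp⟩ : ∃ p, p + q = n := ⟨n - q, by omega⟩
      refine (ModuleCat.epi_iff_surjective _).mpr ?_
      exact surjective_of_square (R := ℤ) (u := (-1 : ℤ) ^ p) ((isUnit_one.neg).pow p)
        (e := (singularHomology.map ℤ ℤ f q ≫ relativeSingularHomology.ofAbsolute ℤ ℤ (↥((𝓡∂ (n + 1)).boundary W)) (Subtype.val ⁻¹' A) q).hom)
        (D' := fun c : singularCohomology ℤ ℤ (↥B) p => capProduct (M := ℤ) hp c cB)
        (ρ := singularCohomology.map ℤ ℤ (subsetIncl B) p)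
        (D := fun a : singularCohomology ℤ ℤ W p => relCapProduct (M := ℤ) ((𝓡∂ (n + 1)).boundary W) (show p + (q + 1) = n + 1 by omega) a z)
        (fun a => tripleδ_relCapProduct ((𝓡∂ (n + 1)).boundary W) A f hp z cB cA hc a)
        (hE q).2 (hDB p q hp).2 (hepiB p (by omega))
    · rw [not_le] at hqn
      exact (hV2 q hqn).epi _
  -- the exact sequence of the triple `A ⊆ ∂W ⊆ W`
  cases k with
  | zero =>
    refine isZero_zero_of_epi_tripleδ hAbd (hθepi 0 fun _ => by omega) ?_
    -- `H₀(W, ∂W) = 0`: `H₀(B) → H₀(W)` is onto (`H₀(W, B) = 0`) and factors through `H₀(∂W)`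
    haveI hepiB : Epi (singularHomology.map ℤ ℤ (subsetIncl B) 0) :=
      (relativeSingularHomology.exact_map_ofAbsolute ℤ ℤ B 0).epi_f ((hyp 0 (Nat.zero_le m)).eq_of_tgt _ _)
    haveI : Epi (singularHomology.map ℤ ℤ f 0 ≫
        singularHomology.map ℤ ℤ (subsetIncl ((𝓡∂ (n + 1)).boundary W)) 0) := by
      rw [← singularHomology.map_comp]; exact hepiB
    haveI : Epi (singularHomology.map ℤ ℤ (subsetIncl ((𝓡∂ (n + 1)).boundary W)) 0) :=
      epi_of_epi (singularHomology.map ℤ ℤ f 0) _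
    have h0 : relativeSingularHomology.ofAbsolute ℤ ℤ W ((𝓡∂ (n + 1)).boundary W) 0 = 0 :=
      (relativeSingularHomology.exact_map_ofAbsolute ℤ ℤ ((𝓡∂ (n + 1)).boundary W) 0).epi_f_iff.mp
        inferInstance
    haveI : Epi (0 : singularHomology ℤ ℤ W 0 ⟶ relativeSingularHomology ℤ ℤ W ((𝓡∂ (n + 1)).boundary W) 0) := by
      rw [← h0]; exact relativeSingularHomology.epi_ofAbsolute_zero ℤ ℤ (X := W) ((𝓡∂ (n + 1)).boundary W)
    exact IsZero.of_epi_zero (singularHomology ℤ ℤ W 0) _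
  | succ i =>
    exact isZero_of_epi_mono_tripleδ hAbd i (hθepi (i + 1) fun _ => by omega) (hθmono i fun _ => by omega)


/-- **Hatcher's Thm. 3.43 with Thm. 3.2, vanishing form (`W : Type`).**  Let `W` be a compact
Hausdorff topological manifold with boundary, charted on `EuclideanHalfSpace (n+1)`, `ℤ`-oriented by
a relative fundamental class `z ∈ Hₙ₊₁(W, ∂W; ℤ)`, whose boundary is the disjoint union of two
closed subsets `A`, `B`.  If `Hⱼ(W, B; ℤ) = 0` for all `j ≤ m` then `Hₖ(W, A; ℤ) = 0` for all `k`
with `n + 1 ≤ k + m` ("`Hₖ(W, A) ≅ Hⁿ⁺¹⁻ᵏ(W, B) = 0`", Wall 1964, p. 146).  Duality on `∂W` comes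
from the boundary orientation — `∂z` generates `Hₙ(∂W | x)` at every `x` (Spanier Cor. 6.3.10:
`boundaryOrientation` for `n ≠ 0`, `isGenerator_toLocal_δ_of_isRelFundamentalClass_holds_zero` for
`n = 0`), so `∂z` is the fundamental class of an orientation of the closed `n`-manifold `∂W`
(Hatcher Thm. 3.26) — and Poincaré duality (Hatcher Thm. 3.30, `poincare_duality`).
[cite: HatcherAT2002, §3.3 Thm. 3.43 with Thm. 3.2; WallJLMS1964, §2, p. 146] -/
theorem isZero_relativeSingularHomology_of_boundary_split_typeZero {m : ℕ}
    {A B : Set W} (hA : IsClosed A) (hB : IsClosed B) (hdisj : Disjoint A B)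
    (hAB : A ∪ B = (𝓡∂ (n + 1)).boundary W)
    (z : relativeSingularHomology ℤ ℤ W ((𝓡∂ (n + 1)).boundary W) (n + 1))
    (hz : IsRelFundamentalClass ℤ ((𝓡∂ (n + 1)).boundary W) z)
    (hyp : ∀ j, j ≤ m → IsZero (relativeSingularHomology ℤ ℤ W B j)) (k : ℕ) (hk : n + 1 ≤ k + m) :
    IsZero (relativeSingularHomology ℤ ℤ W A k) := by
  letI := boundaryTopChartedSpace (n := n) (W := W)
  haveI : CompactSpace ↥((𝓡∂ (n + 1)).boundary W) := isCompact_iff_compactSpace.mp isCompact_boundary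
  refine isZero_relativeSingularHomology_of_boundary_split_of_duality hA hB hdisj hAB z hz ?_ hyp k hk
  -- the orientation of `∂W` whose fundamental class is `∂z`
  let ν : HomologicalOrientation ℤ ↥((𝓡∂ (n + 1)).boundary W) n :=
    { localClass := fun x => singularHomology.toLocal ℤ ℤ x n
        (relativeSingularHomology.δ ℤ ℤ W ((𝓡∂ (n + 1)).boundary W) n z)
      isGenerator := fun x => by
        cases n with
        | zero => exact isGenerator_toLocal_δ_of_isRelFundamentalClass_holds_zero ℤ z hz x
        | succ i => exact isGenerator_toLocal_δ_of_isRelFundamentalClass' ℤ (Nat.succ_ne_zero i) hz x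
      locallyConsistent := fun _ => ⟨univ, Filter.univ_mem, singularHomology.toLocalOfSet ℤ ℤ _ univ n
          (relativeSingularHomology.δ ℤ ℤ W ((𝓡∂ (n + 1)).boundary W) n z),
        fun _ hy => singularHomology.restrictToPoint_toLocalOfSet ℤ ℤ hy n _⟩ }
  have hfc : IsFundamentalClass ν (relativeSingularHomology.δ ℤ ℤ W ((𝓡∂ (n + 1)).boundary W) n z) :=
    fun _ => rfl
  have heq := IsFundamentalClass.fundamentalClass_eq_holds ℤ (↥((𝓡∂ (n + 1)).boundary W)) n hfc
  intro p q h
  have hPD := poincare_duality ν h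
  unfold bijective_poincareDualityMap at hPD
  rw [← heq]
  exact hPD

end Core

end Literature.AlgebraicTopology.SingularHomology

end
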